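import Summits.QuantumFields.YangMills.Theorems.BalabanUVNodesC44IterMhStabilityAlgebra
import Literature.MathematicalPhysics.QuantumFieldTheory.Balaban1983to89.Node00.AveragingSmooth
import HarnessLib

/-!
# (ℓa-C) ROAD B, FILE F4′-2b — THE INTERACTION PICTURE («DRESSING») OF A COMPLEX FIELD OVER THE UNITARY BACKGROUND:
# `Ṽ(Γ) = D(Γ)·W(Γ)` with `D(Γ) := holMh Ṽ Γ · (holM W Γ)⋆`, its concatenation ∕ reversal ∕ single-step rules, `det D = 1`, and `‖D(Γ) − 1‖ ≤ (1+2s)^{|Γ|} − 1`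

Cell `pub-ymgap` ∕ `ym-nodeO-ideate`, porter lineage `ymgap-nodeO-port-PTB-1` (gen 7), hand «(44) for `iterMh`» (director-ym g22 №569/№571; PORT-PLAN-v5 dc7ff9950b0ac185,
§ F4′-2).  `--kind proof --supports stmt-QuantumFields-27238 --as helper`; count-neutral.  [B7] = [Balaban1985Averaging]; [B11] = [Balaban1985Variational]; [I] = [Balaban1987RG1].

WHY.  [B7] Sect. B (58) «`(R_{0,y}V′)(Γ_{y,x}) = ∏_{b⊂Γ_{y,x}} R(V₀(Γ_{y,b₋}))V′_b`» writes the holonomy of a perturbed field `V′V₀` as a product of perturbation factors ROTATED by the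
background transports, times the background holonomy.  For the holomorphic tower of F4′ the perturbed field is a complex `Ṽ` with `det Ṽ(b) = 1` near the `SU(N)` background `W`
(bondwise `‖Ṽ(b)W(b)⋆ − 1‖ ≤ s`), and the dressing factor of a walk `Γ` is simply `D(Γ) := holMh Ṽ Γ · (holM ↑W Γ)⋆` (NO new definition: the tree's holomorphic walk product
✓`B15AveragingHolomorphic.holMh` with adjugates = inverses on `SL(N,ℂ)`, and n07-e's ✓`Node00.holM` of the unitary background).  This file proves the calculus of `D`: it is
multiplicative up to unitary rotations (`D(Γ₁Γ₂) = D(Γ₁)·W(Γ₁)D(Γ₂)W(Γ₁)⋆`), inverts under reversal (`D(Γ⁻¹) = W(Γ)⋆D(Γ)⁻¹W(Γ)`), has determinant one, and deviates from `1` by at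
most `(1+2s)^{|Γ|} − 1` — the sup-norm form of [B7] (20)∕(47) «`|V(Γ) − 1| ≤ …`» along complex perturbations, where unitarity of the background (rotations are isometries,
p.24 «unitarily equivalent») replaces Stokes.

WHAT IS PROVED (0 def, 0 sorry, axioms standard; ns `Summit.QuantumFields.YangMills.Theorems.C44IterMh`; `W : GaugeField P j (SU N)`, `V : PBond P j → M_N(ℂ)`).
* §1 walk products: `holMh_append'`, `holM_append'`, `holM_coeField_mem_unitaryGroup`, `det_holM_coeField`, `star_holM_mul_holM`, `holM_mul_star_holM` (+ right-assoc cancel forms),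
  `det_stepMh_eq_one`, `det_holMh_eq_one_SL`, `stepMh_false_eq_inv`, ★ `holMh_walk_wordRev_of_det` (`Ṽ(Γ⁻¹) = Ṽ(Γ)⁻¹` on `SL(N,ℂ)`), `holM_coeField_walk_wordRev` (`W(Γ⁻¹) = W(Γ)⋆`).
* §2 the dressing: `holMh_eq_dress_mul` (`Ṽ(Γ) = D(Γ)W(Γ)`), ★ `dress_append` ([B7] (58)∕(60) concatenation with rotation), ★ `dress_walk_wordRev` (reversal), `dress_single_true ∕ _false`,
  `det_coe_mul_star_eq_one`, `det_dress_eq_one`, `norm_dress_single_sub_one_le` (`≤ 2s`), `norm_dress_walk_singleton_sub_one_le`, ★★ `norm_dress_walk_sub_one_le`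
  (`‖D(walk x w) − 1‖ ≤ (1+2s)^{|w|} − 1`, induction with unitary isometry).

HONEST FRAMING.  Algebra and one elementary induction over DEFINED objects; nothing of [B7] Props 1–3∕7 or [B11] (44) is proved here.  (ℓa-C)(ℓa-H)(ℓd) DISPLAYED; (R1)∕(R2) OPEN;
K0ᴬ ⟨stmt-QuantumFields-27238⟩ NOT closed; K0ᴬ∕K1ᴬ∕K3ᴬ 0∕3; NODE O 0∕1; COUNT 8∕28 · K 1∕4 UNMOVED; finite `𝕋⁴_{L^K}` at fixed ε — NOT continuum ∕ ℝ⁴ ∕ OS; **the Yang–Mills mass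
gap (Clay) is NOT proved by any of this.**  No `sorry`, `instance`, `notation`, `set_option`; standard axioms.
-/

noncomputable section

open scoped Matrix Matrix.Norms.L2Operator

namespace Summit.QuantumFields.YangMills.Theorems.C44IterMh

open Literature.MathematicalPhysics.QuantumFieldTheory.Balaban1983to89
open Literature.MathematicalPhysics.QuantumFieldTheory.Balaban1983to89.Node00
open T4Continuum BlockAveraging
open B15AveragingHolomorphic (stepMh holMh holMh_nil holMh_cons)

variable {P : Params} {j : ℕ} {N : ℕ}

/-! ## §1  Walk products: concatenation, unitarity of the background transports, determinants, reversal -/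

/-- Holomorphic walk products are multiplicative under concatenation. [cite: Balaban1987RG1, (0.4) p.253 (bookkeeping)] -/
theorem holMh_append' (V : PBond P j → Matrix (Fin N) (Fin N) ℂ) (γ₁ γ₂ : List (LStep P j)) : holMh V (γ₁ ++ γ₂) = holMh V γ₁ * holMh V γ₂ := by
  simp [holMh, List.map_append, List.prod_append]

/-- Matrix walk products are multiplicative under concatenation. [cite: Balaban1987RG1, (0.4) p.253 (bookkeeping)] -/
theorem holM_append' (V : PBond P j → Matrix (Fin N) (Fin N) ℂ) (γ₁ γ₂ : List (LStep P j)) : holM V (γ₁ ++ γ₂) = holM V γ₁ * holM V γ₂ := by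
  simp [holM, List.map_append, List.prod_append]

variable [NeZero N]

/-- The walk products of an `SU(N)` field are unitary matrices (they are the matrices of the tree's holonomies, ✓`coe_holAt`). [cite: Balaban1985Averaging, (9) p.19] -/
theorem holM_coeField_mem_unitaryGroup (W : GaugeField P j (SU N)) (γ : List (LStep P j)) : holM (coeField W) γ ∈ Matrix.unitaryGroup (Fin N) ℂ := by
  rw [← coe_holAt]
  exact Matrix.specialUnitaryGroup_le_unitaryGroup (holAt W γ).2

/-- … and have determinant one. [cite: Balaban1985Averaging, (9) p.19] -/
theorem det_holM_coeField (W : GaugeField P j (SU N)) (γ : List (LStep P j)) : (holM (coeField W) γ).det = 1 := by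
  rw [← coe_holAt]
  exact (Matrix.mem_specialUnitaryGroup_iff.1 (holAt W γ).2).2

/-- `W(Γ)⋆·W(Γ) = 1`. [cite: Balaban1985Averaging, (9) p.19 (bookkeeping)] -/
theorem star_holM_mul_holM (W : GaugeField P j (SU N)) (γ : List (LStep P j)) : star (holM (coeField W) γ) * holM (coeField W) γ = 1 :=
  Unitary.star_mul_self_of_mem (holM_coeField_mem_unitaryGroup W γ)

/-- `W(Γ)·W(Γ)⋆ = 1`. [cite: Balaban1985Averaging, (9) p.19 (bookkeeping)] -/
theorem holM_mul_star_holM (W : GaugeField P j (SU N)) (γ : List (LStep P j)) : holM (coeField W) γ * star (holM (coeField W) γ) = 1 :=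
  Unitary.mul_star_self_of_mem (holM_coeField_mem_unitaryGroup W γ)

/-- Right-associated cancellation `W(Γ)⋆·(W(Γ)·X) = X`. [cite: Balaban1985Averaging, (9) p.19 (bookkeeping)] -/
theorem star_holM_mul_holM_mul (W : GaugeField P j (SU N)) (γ : List (LStep P j)) (X : Matrix (Fin N) (Fin N) ℂ) :
    star (holM (coeField W) γ) * (holM (coeField W) γ * X) = X := by
  rw [← mul_assoc, star_holM_mul_holM, one_mul]

/-- Right-associated cancellation `W(Γ)·(W(Γ)⋆·X) = X`. [cite: Balaban1985Averaging, (9) p.19 (bookkeeping)] -/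
theorem holM_mul_star_holM_mul (W : GaugeField P j (SU N)) (γ : List (LStep P j)) (X : Matrix (Fin N) (Fin N) ℂ) :
    holM (coeField W) γ * (star (holM (coeField W) γ) * X) = X := by
  rw [← mul_assoc, holM_mul_star_holM, one_mul]

omit [NeZero N] in
/-- Holomorphic step matrices of a determinant-one field have determinant one (`det adj A = (det A)^{N−1}`). [cite: Balaban1985Variational, p.307 («Gᶜ-valued fields»)] -/
theorem det_stepMh_eq_one {V : PBond P j → Matrix (Fin N) (Fin N) ℂ} (hdet : ∀ b, (V b).det = 1) (st : LStep P j) : (stepMh V st).det = 1 := by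
  unfold stepMh
  split_ifs
  · exact hdet _
  · rw [Matrix.det_adjugate, hdet, one_pow]

omit [NeZero N] in
/-- Holomorphic walk products of a determinant-one field have determinant one. [cite: Balaban1985Variational, p.307 («Gᶜ-valued fields»)] -/
theorem det_holMh_eq_one_SL {V : PBond P j → Matrix (Fin N) (Fin N) ℂ} (hdet : ∀ b, (V b).det = 1) : ∀ γ : List (LStep P j), (holMh V γ).det = 1
  | [] => by rw [holMh_nil, Matrix.det_one]
  | st :: γ => by rw [holMh_cons, Matrix.det_mul, det_stepMh_eq_one hdet, det_holMh_eq_one_SL hdet γ, one_mul]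

omit [NeZero N] in
/-- On `SL(N,ℂ)`-valued fields the backward step matrix is the inverse. [cite: Balaban1985Variational, p.307 («Gᶜ-valued fields»)] -/
theorem stepMh_false_eq_inv {V : PBond P j → Matrix (Fin N) (Fin N) ℂ} (hdet : ∀ b, (V b).det = 1) (b : PBond P j) : stepMh V ⟨b, false⟩ = (V b)⁻¹ := by
  simp only [stepMh, Bool.false_eq_true, ↓reduceIte]
  exact sl_adjugate_eq_inv (hdet b)

omit [NeZero N] in
/-- ★ **`Ṽ(Γ⁻¹) = Ṽ(Γ)⁻¹` FOR `SL(N,ℂ)`-VALUED FIELDS**: the holomorphic walk product along the reversed word (from the end of the walk) is the inverse (the GROUP-valued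
✓`holAt_walk_wordRev`, with adjugates = inverses). [cite: Balaban1985Averaging, (9) p.19 («U(−b) = U(b)⁻¹»); Balaban1985Variational, p.307] -/
theorem holMh_walk_wordRev_of_det {V : PBond P j → Matrix (Fin N) (Fin N) ℂ} (hdet : ∀ b, (V b).det = 1) : ∀ (x : Site P j) (w : List (Letter P.d)),
    holMh V (walk (walkEnd x w) (wordRev w)) = (holMh V (walk x w))⁻¹
  | x, [] => by simp [walk, walkEnd, wordRev, holMh_nil]
  | x, (μ, true) :: w => by
    have h1 : wordRev ((μ, true) :: w) = wordRev w ++ [(μ, false)] := by rw [wordRev_cons]; rfl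
    rw [h1]
    simp only [walkEnd, walk]
    rw [walk_append, holMh_append', holMh_walk_wordRev_of_det hdet (x.shift μ) w, walkEnd_walkEnd_wordRev, holMh_cons, Matrix.mul_inv_rev]
    simp only [walk, holMh_cons, holMh_nil, Site.unshift_shift, mul_one, stepMh_false_eq_inv hdet]
    simp [stepMh]
  | x, (μ, false) :: w => by
    have h1 : wordRev ((μ, false) :: w) = wordRev w ++ [(μ, true)] := by rw [wordRev_cons]; rfl
    rw [h1]
    simp only [walkEnd, walk]
    rw [walk_append, holMh_append', holMh_walk_wordRev_of_det hdet (x.unshift μ) w, walkEnd_walkEnd_wordRev, holMh_cons, Matrix.mul_inv_rev,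
      stepMh_false_eq_inv hdet, Matrix.nonsing_inv_nonsing_inv _ (sl_isUnit_det (hdet _))]
    simp [walk, holMh_cons, holMh_nil, stepMh]

/-- **`W(Γ⁻¹) = W(Γ)⋆`** for the unitary background (✓`holAt_walk_wordRev` read on matrices). [cite: Balaban1985Averaging, (9) p.19] -/
theorem holM_coeField_walk_wordRev (W : GaugeField P j (SU N)) (x : Site P j) (w : List (Letter P.d)) :
    holM (coeField W) (walk (walkEnd x w) (wordRev w)) = star (holM (coeField W) (walk x w)) := by
  rw [← coe_holAt, ← coe_holAt, holAt_walk_wordRev]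
  rfl

/-! ## §2  The dressing factor `D(Γ) = holMh Ṽ Γ · (holM ↑W Γ)⋆` -/

/-- `Ṽ(Γ) = D(Γ)·W(Γ)` (the background transport is unitary). [cite: Balaban1985Averaging, (58) p.27] -/
theorem holMh_eq_dress_mul (W : GaugeField P j (SU N)) (V : PBond P j → Matrix (Fin N) (Fin N) ℂ) (γ : List (LStep P j)) :
    holMh V γ = (holMh V γ * star (holM (coeField W) γ)) * holM (coeField W) γ := by
  rw [mul_assoc, star_holM_mul_holM, mul_one]

/-- ★ **CONCATENATION WITH ROTATION** ([B7] (58)∕(60)): `D(Γ₁Γ₂) = D(Γ₁) · W(Γ₁)·D(Γ₂)·W(Γ₁)⋆`. [cite: Balaban1985Averaging, (58) p.27, (60) p.28] -/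
theorem dress_append (W : GaugeField P j (SU N)) (V : PBond P j → Matrix (Fin N) (Fin N) ℂ) (γ₁ γ₂ : List (LStep P j)) :
    holMh V (γ₁ ++ γ₂) * star (holM (coeField W) (γ₁ ++ γ₂)) =
      (holMh V γ₁ * star (holM (coeField W) γ₁)) *
        (holM (coeField W) γ₁ * (holMh V γ₂ * star (holM (coeField W) γ₂)) * star (holM (coeField W) γ₁)) := by
  rw [holMh_append', holM_append', star_mul]
  have h := star_holM_mul_holM W γ₁
  symm
  calc holMh V γ₁ * star (holM (coeField W) γ₁) * (holM (coeField W) γ₁ * (holMh V γ₂ * star (holM (coeField W) γ₂)) * star (holM (coeField W) γ₁))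
      = holMh V γ₁ * (star (holM (coeField W) γ₁) * holM (coeField W) γ₁) * (holMh V γ₂ * star (holM (coeField W) γ₂)) * star (holM (coeField W) γ₁) := by
        simp only [mul_assoc]
    _ = holMh V γ₁ * holMh V γ₂ * (star (holM (coeField W) γ₂) * star (holM (coeField W) γ₁)) := by rw [h, mul_one]; simp only [mul_assoc]

/-- ★ **REVERSAL**: `D(Γ⁻¹) = W(Γ)⋆·D(Γ)⁻¹·W(Γ)` (from the end of `Γ`), for `SL(N,ℂ)`-valued `Ṽ`. [cite: Balaban1985Averaging, (9) p.19, (58) p.27] -/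
theorem dress_walk_wordRev (W : GaugeField P j (SU N)) {V : PBond P j → Matrix (Fin N) (Fin N) ℂ} (hdet : ∀ b, (V b).det = 1) (x : Site P j) (w : List (Letter P.d)) :
    holMh V (walk (walkEnd x w) (wordRev w)) * star (holM (coeField W) (walk (walkEnd x w) (wordRev w))) =
      star (holM (coeField W) (walk x w)) * (holMh V (walk x w) * star (holM (coeField W) (walk x w)))⁻¹ * holM (coeField W) (walk x w) := by
  rw [holMh_walk_wordRev_of_det hdet, holM_coeField_walk_wordRev, star_star, Matrix.mul_inv_rev,
    Matrix.inv_eq_left_inv (holM_mul_star_holM W (walk x w))]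
  rw [show star (holM (coeField W) (walk x w)) * (holM (coeField W) (walk x w) * (holMh V (walk x w))⁻¹) * holM (coeField W) (walk x w)
      = (star (holM (coeField W) (walk x w)) * holM (coeField W) (walk x w)) * (holMh V (walk x w))⁻¹ * holM (coeField W) (walk x w) by simp only [mul_assoc],
    star_holM_mul_holM, one_mul]

omit [NeZero N] in
/-- The dressing factor of one forward step: `Ṽ(b)·W(b)⋆`. [cite: Balaban1985Averaging, (58) p.27 (bookkeeping)] -/
theorem dress_single_true (W : GaugeField P j (SU N)) (V : PBond P j → Matrix (Fin N) (Fin N) ℂ) (b : PBond P j) :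
    holMh V [⟨b, true⟩] * star (holM (coeField W) [⟨b, true⟩]) = V b * star (W b : Matrix (Fin N) (Fin N) ℂ) := by
  simp [holMh_cons, holMh_nil, holM_cons, holM_nil, stepMh, stepM, coeField]

omit [NeZero N] in
/-- The dressing factor of one backward step: `W(b)⋆·(Ṽ(b)W(b)⋆)⁻¹·W(b)` (a unitary conjugate of the INVERSE bond factor). [cite: Balaban1985Averaging, (58) p.27 (bookkeeping)] -/
theorem dress_single_false (W : GaugeField P j (SU N)) {V : PBond P j → Matrix (Fin N) (Fin N) ℂ} (hdet : ∀ b, (V b).det = 1) (b : PBond P j) :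
    holMh V [⟨b, false⟩] * star (holM (coeField W) [⟨b, false⟩]) =
      star (W b : Matrix (Fin N) (Fin N) ℂ) * (V b * star (W b : Matrix (Fin N) (Fin N) ℂ))⁻¹ * (W b : Matrix (Fin N) (Fin N) ℂ) := by
  have hW : (W b : Matrix (Fin N) (Fin N) ℂ) * star (W b : Matrix (Fin N) (Fin N) ℂ) = 1 :=
    Unitary.mul_star_self_of_mem (Matrix.specialUnitaryGroup_le_unitaryGroup (W b).2)
  have hW' : star (W b : Matrix (Fin N) (Fin N) ℂ) * (W b : Matrix (Fin N) (Fin N) ℂ) = 1 :=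
    Unitary.star_mul_self_of_mem (Matrix.specialUnitaryGroup_le_unitaryGroup (W b).2)
  rw [holMh_cons, holMh_nil, holM_cons, holM_nil, mul_one, mul_one, stepMh_false_eq_inv hdet]
  simp only [stepM, Bool.false_eq_true, ↓reduceIte, coeField_apply, star_star]
  rw [Matrix.mul_inv_rev, Matrix.inv_eq_left_inv hW, ← mul_assoc, hW', one_mul]

omit [NeZero N] in
/-- `det(Ṽ(b)·W(b)⋆) = 1` for `det Ṽ(b) = 1`, `W(b) ∈ SU(N)`. [cite: Balaban1985Variational, p.307 (bookkeeping)] -/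
theorem det_coe_mul_star_eq_one (W : GaugeField P j (SU N)) {V : PBond P j → Matrix (Fin N) (Fin N) ℂ} (hdet : ∀ b, (V b).det = 1) (b : PBond P j) :
    (V b * star (W b : Matrix (Fin N) (Fin N) ℂ)).det = 1 := by
  rw [Matrix.det_mul, hdet, Matrix.star_eq_conjTranspose, Matrix.det_conjTranspose, (Matrix.mem_specialUnitaryGroup_iff.1 (W b).2).2, star_one, one_mul]

/-- `det D(Γ) = 1`. [cite: Balaban1985Variational, p.307 (bookkeeping)] -/
theorem det_dress_eq_one (W : GaugeField P j (SU N)) {V : PBond P j → Matrix (Fin N) (Fin N) ℂ} (hdet : ∀ b, (V b).det = 1) (γ : List (LStep P j)) :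
    (holMh V γ * star (holM (coeField W) γ)).det = 1 := by
  rw [Matrix.det_mul, det_holMh_eq_one_SL hdet, Matrix.star_eq_conjTranspose, Matrix.det_conjTranspose, det_holM_coeField, star_one, one_mul]

/-- The single-step dressing factors are within `2s` of `1` when `‖Ṽ(b)W(b)⋆ − 1‖ ≤ s ≤ 1∕2` (forward: `s`; backward: the inverse, `2s`, unitary conjugation is isometric).
[cite: Balaban1985Averaging, (20) p.21, (47) p.25] -/
theorem norm_dress_single_sub_one_le (W : GaugeField P j (SU N)) {V : PBond P j → Matrix (Fin N) (Fin N) ℂ} (hdet : ∀ b, (V b).det = 1) {s : ℝ}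
    (hs : ∀ b, ‖V b * star (W b : Matrix (Fin N) (Fin N) ℂ) - 1‖ ≤ s) (hs2 : s ≤ 1 / 2) (st : LStep P j) :
    ‖holMh V [st] * star (holM (coeField W) [st]) - 1‖ ≤ 2 * s := by
  have hs0 : 0 ≤ s := (norm_nonneg _).trans (hs st.bond)
  obtain ⟨b, fb⟩ := st
  cases fb
  · rw [dress_single_false W hdet b, norm_star_unitary_conj_sub_one_eq (Matrix.specialUnitaryGroup_le_unitaryGroup (W b).2)]
    exact norm_inv_sub_one_le_of_det (sl_isUnit_det (det_coe_mul_star_eq_one W hdet b)) (hs b) hs2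
  · rw [dress_single_true]
    linarith [hs b]

/-- The walk of a single letter has a single step, so its dressing factor is within `2s` of `1`. [cite: Balaban1985Averaging, (20) p.21 (bookkeeping)] -/
theorem norm_dress_walk_singleton_sub_one_le (W : GaugeField P j (SU N)) {V : PBond P j → Matrix (Fin N) (Fin N) ℂ} (hdet : ∀ b, (V b).det = 1) {s : ℝ}
    (hs : ∀ b, ‖V b * star (W b : Matrix (Fin N) (Fin N) ℂ) - 1‖ ≤ s) (hs2 : s ≤ 1 / 2) (x : Site P j) (l : Letter P.d) :
    ‖holMh V (walk x [l]) * star (holM (coeField W) (walk x [l])) - 1‖ ≤ 2 * s := by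
  obtain ⟨μ, fb⟩ := l
  cases fb
  · exact norm_dress_single_sub_one_le W hdet hs hs2 ⟨⟨x.unshift μ, μ⟩, false⟩
  · exact norm_dress_single_sub_one_le W hdet hs hs2 ⟨⟨x, μ⟩, true⟩

/-- ★★ **THE DRESSING FACTOR OF A WALK IS WITHIN `(1+2s)^{|w|} − 1` OF `1`** (induction on the word: concatenation with rotation, unitary rotations are isometries) — the
sup-norm form of [B7] (47)∕(111) along complex perturbations. [cite: Balaban1985Averaging, (47) p.25, (111) p.34, p.24 («unitarily equivalent»)] -/
theorem norm_dress_walk_sub_one_le (W : GaugeField P j (SU N)) {V : PBond P j → Matrix (Fin N) (Fin N) ℂ} (hdet : ∀ b, (V b).det = 1) {s : ℝ}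
    (hs : ∀ b, ‖V b * star (W b : Matrix (Fin N) (Fin N) ℂ) - 1‖ ≤ s) (hs2 : s ≤ 1 / 2) : ∀ (x : Site P j) (w : List (Letter P.d)),
    ‖holMh V (walk x w) * star (holM (coeField W) (walk x w)) - 1‖ ≤ (1 + 2 * s) ^ w.length - 1
  | x, [] => by simp [walk, holMh_nil, holM_nil]
  | x, l :: w => by
    have ih := norm_dress_walk_sub_one_le W hdet hs hs2 (walkEnd x [l]) w
    rw [show l :: w = [l] ++ w from rfl, walk_append, dress_append, List.length_append, List.length_singleton, pow_add, pow_one]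
    have h1 := norm_dress_walk_singleton_sub_one_le W hdet hs hs2 x l
    have h2 : ‖holM (coeField W) (walk x [l]) * (holMh V (walk (walkEnd x [l]) w) * star (holM (coeField W) (walk (walkEnd x [l]) w))) *
        star (holM (coeField W) (walk x [l])) - 1‖ ≤ (1 + 2 * s) ^ w.length - 1 := by
      rw [norm_unitary_conj_sub_one_eq (holM_coeField_mem_unitaryGroup W _)]
      exact ih
    refine (norm_mul_sub_one_le_of_le₂ h1 h2).trans (le_of_eq ?_)
    ring

end Summit.QuantumFields.YangMills.Theorems.C44IterMh

end
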